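/-
Copyright (c) 2026. All rights reserved.
Released under Apache 2.0 license as described in the file LICENSE.
Authors: HodgeCM-Mathlib publication cell (pub/hodgecm-mathlib), floor-0 programme P4, seat F0P4-p06 (S4a lead).
-/
import Literature.NumberTheory.Automorphic.Liu2021.Def411WeilCarriersAtLineTwoLinesTransport
import HarnessLib

/-!
# Transport of `ω(μ, ε, χ)` between two lines: the `U(J_V)`-members ALONE suffice

Topic `NumberTheory/Automorphic/Liu2021`; namespace `Literature.NumberTheory.Automorphic.Liu2021.Def411WeilCarriers` (sequel of ★
`Def411WeilCarriersAtLineTwoLinesTransport`, brick (T0) of the line-class transport `lineClassTransport_equiv` — stub S4a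
`StubT3aLineTransportAt` of the cell's crux H413, letter (C′) of P2).  THEOREMS ONLY; nothing of [Liu2021] or [GelbartRogawski1991] is
asserted.

(T0) (`exists_omegaAtLine_equiv_rhoVAtLine_of_twoLines`) descends a linear automorphism `Q` of the finite Schwartz–Bruhat module
`𝒮((𝔸_F^∞)^{N×1})` to an isomorphism `omegaAtLine … a χ ≃ₗ[ℂ] omegaAtLine … a′ χ`, equivariant for `rhoVAtLine`, from TWO intertwining
hypotheses: (hQV) for the `U(J_V)`-members `finPairRepV[a]`, `finPairRepV[a′]` and (hQW) for the `W`-members read through the norm-one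
torus `E¹(𝔸_{F,f})` (`finPairRepW[b] ∘ lineCenterEquiv b`).  This file removes (hQW): for a hermitian LINE `W = ⟨b⟩` the torus
`U(⟨b⟩)(𝔸_{F,f}) = E¹(𝔸_{F,f}) · 1_W` acts through the CENTRE of `U(J_V)`, because in the big unitary group `U(J_V ⊗ J_W)(𝔸_F)` one has
`(u · 1_V) ⊗ 1 = 1 ⊗ (u · 1_W)` ([GelbartRogawski1991, §3.1 p. 454]; [Mok2014, §1 Notation p. 5]: the centre of `U(N)` is `U(1)`), so
that `finPairRepW[b] (u · 1_W) = finPairRepV[b] (u · 1_V)` for EVERY compatible pair splitting (★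
`UnitaryDualPairWeilCoinvariantsCenter.finPairRepV_finAdelicCenter`) — and `lineCenterEquiv b u = u · 1_W` (★ `lineCenterEquiv_apply`):

* `finPairRepW_lineCenterEquiv_eq_finPairRepV_finAdelicCenter` — the `W`-member through `E¹(𝔸_f)` IS the `V`-member at the centre;
* **`exists_omegaAtLine_equiv_rhoVAtLine_of_twoLines_V`** — (T0) from (hQV) ALONE;
* `exists_omegaAtLine_equiv_rhoVAtLine_of_twoLines_V_smul` — the `λ`-twisted form, from (hQV) up to a scalar `λ k` with `λ = 1` on
  the centre `E¹(𝔸_f) · 1_V`.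

Consequence for the line-class transport: the MASTER `lineClassTransport_equiv` needs only an automorphism of `𝒮((𝔸_F^∞)^{N×1})`
intertwining the two `U(J_V)(𝔸_{F,f})`-representations `finPairRepV[a]`, `finPairRepV[a′]` — i.e. that these two representations of ONE
group are isomorphic.

## References
* [Liu2021] Y. Liu, Camb. J. Math. 9 (2021) = arXiv:2102.11518: Def. 4.11 (l. 2092–2096), App. D §D.1 Step 1 footnote (l. 5215), Step 3
  (l. 5219–5221).
* [GelbartRogawski1991] S. Gelbart, J. Rogawski, Invent. Math. 105 (1991), §3.1 p. 454, Prop. 3.1.1 p. 455, Remark p. 457 L4–13.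
* [Mok2014] C. P. Mok, Mem. AMS 235 (2015), §1 Notation p. 5.
-/

set_option autoImplicit false

noncomputable section

namespace Literature.NumberTheory.Automorphic.Liu2021.Def411WeilCarriers

open Literature.NumberTheory.Automorphic Literature.NumberTheory.Automorphic.UnitaryGroup
open Literature.NumberTheory.GelbartRogawski1991 Literature.NumberTheory.GelbartRogawski1991.UnitaryDualPair
open Literature.NumberTheory.GelbartRogawski1991.UnitaryDualPair.WeilCoinv
open Literature.NumberTheory.Weil1964 Literature.RepresentationTheory

section TwoLinesV

variable (F E : Type) [Field F] [NumberField F] [Field E] [NumberField E] [Algebra F E]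
variable (c : E ≃ₐ[F] E) (N : ℕ) {n : ℕ} (e : Fin N × Fin 1 ≃ Fin n)
variable (JV : Matrix (Fin N) (Fin N) E) {TV : Matrix (Fin N) (Fin N) F}
variable [Algebra.IsQuadraticExtension F E] {δ : E} (hcδ : c δ = -δ) (hδ : δ ≠ 0) {d : F}
  (hd : δ * δ = algebraMap F E d) (hV : TV.IsSymm) (hVd : IsUnit TV.det) (hJV : JV = TV.map (algebraMap F E))
variable {s : ∀ a : Fˣ, UnitaryGroup.adelicPair F E c N 1 JV (JW F E a) →* adelicMpCont F (Fin n) (adelicGram F e TV (TW F a))}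
  (hs : ∀ a : Fˣ, (splittingDatum F E c N 1 e JV (JW F E a) hcδ hδ hd hV (isSymm_TW F a) hVd (isUnit_det_TW F a) hJV
    (JW_eq F E a)).IsCompatible (s a))
variable (a a' : Fˣ) (χ : Chi F E c) (Q : FinSB F (Fin N × Fin 1) ≃ₗ[ℂ] FinSB F (Fin N × Fin 1))

/-- **the `W`-member through the norm-one torus is the `V`-member at the centre**: for a hermitian line `⟨b⟩`,
`finPairRepW[b] (lineCenterEquiv b u) = finPairRepV[b] (u · 1_V)` for every norm-one finite idèle `u` — since
`(u · 1_V) ⊗ 1 = 1 ⊗ (u · 1_W)` in `U(J_V ⊗ ⟨b⟩)(𝔸_F)` (★ `finPairRepV_finAdelicCenter`) and `lineCenterEquiv b u = u · 1_W`.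
[cite: GelbartRogawski1991, §3.1 p. 454] [cite: Liu2021, App. D §D.1 Step 3 (l. 5219–5221)] -/
theorem finPairRepW_lineCenterEquiv_eq_finPairRepV_finAdelicCenter (b : Fˣ) (u : UnitaryGroup.finAdelicOne F E c) :
    finPairRepW F E c N 1 e JV (JW F E b) hcδ hδ hd hV (isSymm_TW F b) hVd (isUnit_det_TW F b) hJV (JW_eq F E b) (hs b)
        (lineCenterEquiv F E c b u) =
      finPairRepV F E c N 1 e JV (JW F E b) hcδ hδ hd hV (isSymm_TW F b) hVd (isUnit_det_TW F b) hJV (JW_eq F E b) (hs b)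
        (UnitaryGroup.finAdelicCenter F E c N JV u) := by
  rw [lineCenterEquiv_apply]
  exact (finPairRepV_finAdelicCenter F E c N 1 e JV (JW F E b) hcδ hδ hd hV (isSymm_TW F b) hVd (isUnit_det_TW F b) hJV
    (JW_eq F E b) (hs b) u).symm

/-- **(T0) from the `U(J_V)`-members alone, `λ`-twisted form**: if `Q` intertwines `finPairRepV[a]` and `finPairRepV[a′]` up to a
scalar `λ k` which is `1` on the centre `u · 1_V` (`u ∈ E¹(𝔸_{F,f})`), then `Ψ [f] = [Q f]` is a linear equivalence
`omegaAtLine … a χ ≃ₗ[ℂ] omegaAtLine … a′ χ` with `rhoVAtLine a′ χ k (Ψ x) = λ k • Ψ (rhoVAtLine a χ k x)` — the torus hypothesis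
(hQW) of `exists_omegaAtLine_equiv_rhoVAtLine_of_twoLines_smul` being the centre case of (hQV).
[cite: GelbartRogawski1991, §3.1 Remark p. 457 L4–13] [cite: Liu2021, Def. 4.11 (l. 2092–2096); App. D §D.1 Step 1 footnote (l. 5215)] -/
theorem exists_omegaAtLine_equiv_rhoVAtLine_of_twoLines_V_smul (lam : UnitaryGroup.finAdelic F E c N JV → ℂ)
    (hlam : ∀ u : UnitaryGroup.finAdelicOne F E c, lam (UnitaryGroup.finAdelicCenter F E c N JV u) = 1)
    (hQV : ∀ (k : UnitaryGroup.finAdelic F E c N JV) (f : FinSB F (Fin N × Fin 1)),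
      finPairRepV F E c N 1 e JV (JW F E a') hcδ hδ hd hV (isSymm_TW F a') hVd (isUnit_det_TW F a') hJV (JW_eq F E a') (hs a')
          k (Q f) =
        lam k • Q (finPairRepV F E c N 1 e JV (JW F E a) hcδ hδ hd hV (isSymm_TW F a) hVd (isUnit_det_TW F a) hJV (JW_eq F E a)
          (hs a) k f)) :
    ∃ Ψ : omegaAtLine F E c N e JV hcδ hδ hd hV hVd hJV hs a χ ≃ₗ[ℂ] omegaAtLine F E c N e JV hcδ hδ hd hV hVd hJV hs a' χ,
      (∀ f : FinSB F (Fin N × Fin 1),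
        Ψ (TwistedCoinv.mk _ (lineChar F E c a χ.1) f) = TwistedCoinv.mk _ (lineChar F E c a' χ.1) (Q f)) ∧
      ∀ (k : UnitaryGroup.finAdelic F E c N JV) (x : omegaAtLine F E c N e JV hcδ hδ hd hV hVd hJV hs a χ),
        rhoVAtLine F E c N e JV hcδ hδ hd hV hVd hJV hs a' χ k (Ψ x) =
          lam k • Ψ (rhoVAtLine F E c N e JV hcδ hδ hd hV hVd hJV hs a χ k x) := by
  refine exists_omegaAtLine_equiv_rhoVAtLine_of_twoLines_smul F E c N e JV hcδ hδ hd hV hVd hJV hs a a' χ Q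
    (fun u f => ?_) lam hQV
  rw [finPairRepW_lineCenterEquiv_eq_finPairRepV_finAdelicCenter F E c N e JV hcδ hδ hd hV hVd hJV hs a',
    finPairRepW_lineCenterEquiv_eq_finPairRepV_finAdelicCenter F E c N e JV hcδ hδ hd hV hVd hJV hs a, hQV, hlam, one_smul]

/-- **(T0) from the `U(J_V)`-members alone**: a linear automorphism `Q` of `𝒮((𝔸_F^∞)^{N×1})` intertwining ON THE NOSE the two
`U(J_V)(𝔸_{F,f})`-representations `finPairRepV[a]`, `finPairRepV[a′]` descends to `Ψ : omegaAtLine … a χ ≃ₗ[ℂ] omegaAtLine … a′ χ`,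
`Ψ [f] = [Q f]`, intertwining `rhoVAtLine a χ` and `rhoVAtLine a′ χ` — the `W`-members follow from the `V`-members at the centre
(`finPairRepW_lineCenterEquiv_eq_finPairRepV_finAdelicCenter`; the `λ = 1` case of `…_of_twoLines_V_smul`).  So the line-class
transport of [Liu2021, App. D §D.1 Step 1 footnote] needs exactly: the two `U(J_V)(𝔸_{F,f})`-representations `finPairRepV[a]`,
`finPairRepV[a′]` on `𝒮((𝔸_F^∞)^{N×1})` are isomorphic.
[cite: GelbartRogawski1991, §3.1 Remark p. 457 L4–13] [cite: Liu2021, Def. 4.11 (l. 2092–2096); App. D §D.1 Step 1 footnote (l. 5215), Step 3 (l. 5221)] -/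
theorem exists_omegaAtLine_equiv_rhoVAtLine_of_twoLines_V
    (hQV : ∀ (k : UnitaryGroup.finAdelic F E c N JV) (f : FinSB F (Fin N × Fin 1)),
      finPairRepV F E c N 1 e JV (JW F E a') hcδ hδ hd hV (isSymm_TW F a') hVd (isUnit_det_TW F a') hJV (JW_eq F E a') (hs a')
          k (Q f) =
        Q (finPairRepV F E c N 1 e JV (JW F E a) hcδ hδ hd hV (isSymm_TW F a) hVd (isUnit_det_TW F a) hJV (JW_eq F E a)
          (hs a) k f)) :
    ∃ Ψ : omegaAtLine F E c N e JV hcδ hδ hd hV hVd hJV hs a χ ≃ₗ[ℂ] omegaAtLine F E c N e JV hcδ hδ hd hV hVd hJV hs a' χ,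
      (∀ f : FinSB F (Fin N × Fin 1),
        Ψ (TwistedCoinv.mk _ (lineChar F E c a χ.1) f) = TwistedCoinv.mk _ (lineChar F E c a' χ.1) (Q f)) ∧
      ∀ (k : UnitaryGroup.finAdelic F E c N JV) (x : omegaAtLine F E c N e JV hcδ hδ hd hV hVd hJV hs a χ),
        rhoVAtLine F E c N e JV hcδ hδ hd hV hVd hJV hs a' χ k (Ψ x) =
          Ψ (rhoVAtLine F E c N e JV hcδ hδ hd hV hVd hJV hs a χ k x) := by
  obtain ⟨Ψ, hmk, hΨ⟩ := exists_omegaAtLine_equiv_rhoVAtLine_of_twoLines_V_smul F E c N e JV hcδ hδ hd hV hVd hJV hs a a' χ Q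
    (fun _ => 1) (fun _ => rfl) (fun k f => by rw [one_smul]; exact hQV k f)
  exact ⟨Ψ, hmk, fun k x => by rw [hΨ, one_smul]⟩

end TwoLinesV

end Literature.NumberTheory.Automorphic.Liu2021.Def411WeilCarriers

end
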